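import Mathlib
import HarnessLib
import Literature.Analysis.FluidPDE.AlbrittonBarkerForwardHolds
import Literature.Analysis.FluidPDE.LocalTypeIBlowup.CurlCompactness
import Literature.Analysis.FluidPDE.DirectionDissipation

/-!
# Blow-up at a local Type I singular point, file 12: a bounded Oseen-mild blow-up limit
# together with the convergence of the zoomed vorticities

Analysis/FluidPDE proof file (theorems only: no definition, no named fact, no `sorry`), twelfth
file of the Literature port `LocalTypeIBlowup/*` (Seregin–Šverák 2009, §2 / Albritton–Barker 2019,
§3). The assembly `exists_ancientMild_of_localTypeISingularPoint`
(`AlbrittonBarkerForwardHolds.lean`) produces from a local Type I singular point a non-trivial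
bounded mild ancient solution; geometric regularity criteria that argue on the VORTICITY of that
blow-up limit (Giga–Miura 2011, Thm. 2.10 and Rmk. 2.11, HUPS preprint #956 p. 11: "We do not
prove Theorem 2.10 because it is almost parallel as the proof of Theorem 1.1. The only difference
is the compactness argument which justifies convergence of sequences of the rescaled local
solutions. For the purpose we invoke a result in Seregin and Sverak [SS, Theorem 2.8], which says
that the rescaled solutions constructed by same way as in Section 2.1 are Hölder continuous
locally uniformly in `ℝ³ × (−∞, 0]`, and then the subsequence converges to some backward global
mild solution `u` locally uniformly in `ℝ³ × (−∞, 0]`"; Barker–Prange 2020, Thm. 3) need the same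
limit WITH the convergence of the zoomed vorticities. This file re-runs the
assembly (point picking `exists_approximants`, slab limit `local_typeI_compactness`, truncation,
Oseen-mild representative `exists_oseenMild_repr_of_bounded`, non-triviality
`exists_eLpNorm_lower_bound`), inserts the `C¹_loc` compactness of file `CurlCompactness`
(`exists_subseq_curl_limit`), identifies the `C¹` limit with the Oseen-mild representative (two
continuous representatives of the `L³_loc` limit agree on the open slab), and transports the
vorticity of the representatives back to the input field: the `k`-th approximant is
`λ_k u(t_k + λ_k² s, x_k + λ_k y)` up to a null set (the point picking works on an everywhere-defined
modification `uh = u` a.e.; `quasiMeasurePreserving_stAffine`), so by Fubini on the parabolic ball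
and continuity of both slices (`Measure.eqOn_open_of_ae_eq`) their curls agree with
`λ_k² curl u(t_k + λ_k² s)(x_k + λ_k y)` (`curl_smul_stPull`) for a.e. time `s`, which yields

* `exists_oseenMild_blowupLimit_curl` — unit-ball form: from a suitable weak solution in `Q(0, 1)`
  with `𝐈(Q(0, 1)) < ∞`, backward singular vertex and `C¹` slices, a continuous, weakly
  divergence-free, Oseen-mild, bounded-by-`1`, suitable, non-trivial ancient field `Vo` with
  `𝐈 < ∞` and differentiable slices, zoom data `Λ j → 0`, `T j`, `X j`, and, for a.e. `s < 0` and
  all `y`, `Λ j² curl u(T j + Λ j² s)(X j + Λ j y) → curl Vo(s)(y)`.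

Nothing here is a claim about Navier–Stokes regularity; no new notion is introduced.

## References

* G. Seregin, V. Šverák, Comm. PDE 34 (2009) = arXiv:0804.1803, §2: Thm. 2.8 (p. 7: "a
  subsequence `{u^{k_j}}` of `{u^k}` converges uniformly on compact subsets of `ℝⁿ × ]−∞, 0]` to a
  mild bounded ancient solution `u` with `|u(0,0)| = 1`") and the higher-derivative bounds of p. 8.
  [SereginSverak2009]
* D. Albritton, T. Barker, J. Math. Fluid Mech. 21 (2019) = arXiv:1811.00502, Prop. 2.4, §3.
  [AlbrittonBarker2019]
* Y. Giga, H. Miura, Comm. Math. Phys. 303 (2011) 289–300 (HUPS preprint #956), §2.1 p. 6,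
  Thm. 2.10 (p. 10), Rmk. 2.11 (p. 11). [GigaMiura2011]
-/

noncomputable section

open MeasureTheory Set Function Filter Topology TopologicalSpace Metric
open scoped NNReal ENNReal
open Literature.Analysis Literature.Analysis.FluidPDE

namespace Literature.Analysis.FluidPDE.LocalTypeIBlowup

/-! ### Preliminaries -/

/-- The lower half-slab is exhausted by the parabolic balls `Q(0, n+1)`. [folklore] -/
private theorem lowerHalf_subset_iUnion' :
    Iio (0 : ℝ) ×ˢ (univ : Set (EuclideanSpace ℝ (Fin 3))) ⊆
      ⋃ n : ℕ, parabolicCylinder ((n : ℝ) + 1) (0 : ℝ × (EuclideanSpace ℝ (Fin 3))) := by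
  rintro ⟨t, x⟩ ⟨ht, -⟩
  obtain ⟨n, hn⟩ := exists_nat_gt (max (Real.sqrt (-t)) ‖x‖)
  refine mem_iUnion.2 ⟨n, ?_⟩
  rw [mem_parabolicCylinder]
  have h1 : Real.sqrt (-t) < (n : ℝ) + 1 := (le_max_left _ _).trans_lt (hn.trans (lt_add_one _))
  have h2 : ‖x‖ < (n : ℝ) + 1 := (le_max_right _ _).trans_lt (hn.trans (lt_add_one _))
  have h3 : -t < ((n : ℝ) + 1) ^ 2 := by
    have hs := Real.sq_sqrt (neg_pos.2 (show t < 0 from ht)).le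
    nlinarith [Real.sqrt_nonneg (-t)]
  refine ⟨⟨?_, ?_⟩, ?_⟩
  · show (0 : ℝ) - ((n : ℝ) + 1) ^ 2 < t
    linarith
  · exact ht
  · simpa [dist_zero_right] using h2

/-- The parabolic ball at the origin as a product set. [folklore] -/
private theorem parabolicCylinder_zero_eq' (R : ℝ) :
    parabolicCylinder R (0 : ℝ × (EuclideanSpace ℝ (Fin 3))) =
      Ioo (-R ^ 2) 0 ×ˢ ball (0 : (EuclideanSpace ℝ (Fin 3))) R := by
  ext w
  simp [parabolicCylinder, mem_prod]

/-- Fubini for a.e. statements on the parabolic ball `Q(0, R)`: a property holding a.e. on the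
ball holds, for a.e. time `s ∈ (−R², 0)`, at a.e. point of `B(0, R)`. [folklore] -/
private theorem ae_ae_of_ae_parabolicCylinder {R : ℝ} {P : ℝ × (EuclideanSpace ℝ (Fin 3)) → Prop}
    (h : ∀ᵐ w ∂(volume.restrict (parabolicCylinder R (0 : ℝ × (EuclideanSpace ℝ (Fin 3))))), P w) :
    ∀ᵐ s ∂(volume.restrict (Ioo (-R ^ 2) (0 : ℝ))),
      ∀ᵐ y ∂(volume.restrict (ball (0 : (EuclideanSpace ℝ (Fin 3))) R)), P (s, y) := by
  rw [parabolicCylinder_zero_eq', Measure.volume_eq_prod, ← Measure.prod_restrict] at h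
  exact Measure.ae_ae_of_ae_prod h

/-- Two slices continuous on an open ball of `ℝ³` and a.e. equal there agree on the ball. [folklore] -/
private theorem eqOn_ball_of_ae_eq {R : ℝ} {f g : (EuclideanSpace ℝ (Fin 3)) → (EuclideanSpace ℝ (Fin 3))}
    (h : ∀ᵐ y ∂(volume.restrict (ball (0 : (EuclideanSpace ℝ (Fin 3))) R)), f y = g y)
    (hf : ContinuousOn f (ball 0 R)) (hg : ContinuousOn g (ball 0 R)) : EqOn f g (ball 0 R) :=
  Measure.eqOn_open_of_ae_eq h isOpen_ball hf hg

/-- The curls of two fields agreeing on an open ball agree on the ball. [folklore] -/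
private theorem curl_eq_of_eqOn_ball {R : ℝ} {f g : (EuclideanSpace ℝ (Fin 3)) → (EuclideanSpace ℝ (Fin 3))}
    (h : EqOn f g (ball 0 R)) {y : (EuclideanSpace ℝ (Fin 3))} (hy : y ∈ ball (0 : (EuclideanSpace ℝ (Fin 3))) R) :
    curl f y = curl g y := by
  have hev : f =ᶠ[𝓝 y] g := by
    filter_upwards [isOpen_ball.mem_nhds hy] with x hx
    exact h hx
  rw [curl_eq_curlCLM, curl_eq_curlCLM, hev.fderiv_eq]


/-! ### The theorem -/

/-- **Blow-up at a local Type I singular point with convergence of the zoomed vorticities**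
(Seregin–Šverák 2009, Thm. 2.8 / Albritton–Barker 2019, §3, `C¹_loc` form; cf. Giga–Miura 2011,
§2.1 p. 6: "Thus we can find a subsequence (still denoted `u_k`, `ω_k`) which converges to bounded
continuous functions `u` and `ω` locally uniformly in `ℝ³ × (−∞, 0]`", and §2.2 Remark 2.11
(p. 11), which runs the local Theorem 2.10 on the limit of "[SS, Theorem 2.8]"). Let `(u, p)` be a suitable weak solution of Navier–Stokes (`ν = 1`) in the unit parabolic
ball `Q(0, 1)` with a weak gradient `G`, finite Type I quantity `𝐈(Q(0, 1)) < ∞`, the vertex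
`(0, 0)` backward singular, and `C¹` slices `u(t, ·)` on `B(0, 1)` for `−1 < t < 0` (the local
regularity under which `curl u` is meant pointwise). Then there are: an ancient field `Vo` on
`(−∞, 0) × ℝ³` — continuous, weakly divergence-free, Oseen-mild (`ν = 1`), bounded by `1`,
suitable with a pressure `P` and a weak gradient `H`, `𝐈 < ∞`, NOT a.e. zero, with differentiable
slices — and zoom data `Λ j > 0`, `Λ j → 0`, times `T j` and centres `X j` (the zooms
`y ↦ Λ j u(T j + Λ j² s, X j + Λ j y)` staying inside `Q(0, 1)`), such that for a.e. `s < 0` and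
every `y` the zoomed vorticities converge to the vorticity of the limit:
`Λ j² curl u(T j + Λ j² s)(X j + Λ j y) → curl Vo(s)(y)`.
[cite: SereginSverak2009, Thm 2.8 (§2, p. 7) with §2 p. 8; AlbrittonBarker2019, §3; GigaMiura2011, §2.1 p. 6 and Rmk 2.11 p. 11 (HUPS preprint #956)] -/
theorem exists_oseenMild_blowupLimit_curl
    {u : ℝ → (EuclideanSpace ℝ (Fin 3)) → (EuclideanSpace ℝ (Fin 3))} {p : ℝ → (EuclideanSpace ℝ (Fin 3)) → ℝ}
    {G : ℝ → (EuclideanSpace ℝ (Fin 3)) → (EuclideanSpace ℝ (Fin 3)) →L[ℝ] (EuclideanSpace ℝ (Fin 3))}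
    (hball : IsSuitableWeakSolutionInBall 1 (0 : ℝ × (EuclideanSpace ℝ (Fin 3))) u p)
    (hwg : HasWeakSpatialGradientOn (parabolicCylinderOpens 1 (0 : ℝ × (EuclideanSpace ℝ (Fin 3)))) u G)
    (hI : typeIBound (parabolicCylinder 1 (0 : ℝ × (EuclideanSpace ℝ (Fin 3)))) u p G < ⊤)
    (hsing : IsBackwardSingularPoint u 0)
    (hC1 : ∀ t ∈ Ioo (-1 : ℝ) 0, ContDiffOn ℝ 1 (u t) (ball (0 : (EuclideanSpace ℝ (Fin 3))) 1)) :
    ∃ (Vo : ℝ → (EuclideanSpace ℝ (Fin 3)) → (EuclideanSpace ℝ (Fin 3))) (P : ℝ → (EuclideanSpace ℝ (Fin 3)) → ℝ)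
      (H : ℝ → (EuclideanSpace ℝ (Fin 3)) → (EuclideanSpace ℝ (Fin 3)) →L[ℝ] (EuclideanSpace ℝ (Fin 3)))
      (Λ T : ℕ → ℝ) (X : ℕ → (EuclideanSpace ℝ (Fin 3))),
      ContinuousOn (uncurry Vo) (Iio 0 ×ˢ univ) ∧
      (∀ t < 0, IsWeaklyDivFree (Vo t)) ∧
      (∀ s t : ℝ, s < t → t < 0 → ∀ x,
        Vo t x = UnboundedOperators.heatExtension (Vo s) (t - s) x - oseenDuhamel 1 s Vo Vo t x) ∧
      (∀ t < 0, ∀ x, ‖Vo t x‖ ≤ 1) ∧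
      IsSuitableWeakSolutionOn (slab (EuclideanSpace ℝ (Fin 3)) (Iio 0) isOpen_Iio) 1 0 Vo P ∧
      HasWeakSpatialGradientOn (slab (EuclideanSpace ℝ (Fin 3)) (Iio 0) isOpen_Iio) Vo H ∧
      ¬ (uncurry Vo =ᵐ[volume.restrict (Iio (0 : ℝ) ×ˢ (univ : Set (EuclideanSpace ℝ (Fin 3))))] 0) ∧
      typeIBound (Iio (0 : ℝ) ×ˢ (univ : Set (EuclideanSpace ℝ (Fin 3)))) Vo P H < ⊤ ∧
      (∀ t < 0, ∀ x, DifferentiableAt ℝ (Vo t) x) ∧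
      (∀ j, 0 < Λ j) ∧ Tendsto Λ atTop (𝓝 0) ∧
      (∀ s < 0, ∀ y : (EuclideanSpace ℝ (Fin 3)), ∀ᶠ j in atTop,
        T j + Λ j ^ 2 * s ∈ Ioo (-1 : ℝ) 0 ∧ X j + Λ j • y ∈ ball (0 : (EuclideanSpace ℝ (Fin 3))) 1) ∧
      (∀ᵐ s ∂(volume.restrict (Iio (0 : ℝ))), ∀ y : (EuclideanSpace ℝ (Fin 3)),
        Tendsto (fun j => (Λ j ^ 2) • curl (u (T j + Λ j ^ 2 * s)) (X j + Λ j • y)) atTop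
          (𝓝 (curl (Vo s) y))) := by
  -- ## Step 1: the blow-up sequence (point picking)
  obtain ⟨v, q, Gz, zs, lam, uh, hlam, hae, hvform, hbox, hballs, hgrads, hIs, hbd1, hvtx, hcontAt,
    hcontOn⟩ := exists_approximants hball hwg hsing
  -- ## Step 2: the slab limit in `L³_loc`
  obtain ⟨U, P, H, σ, hσ, hswU, hHU, h4I, hmemU, hconvU⟩ :=
    local_typeI_compactness (typeIBound (parabolicCylinder 1 (0 : ℝ × (EuclideanSpace ℝ (Fin 3)))) u p G) v q Gz hI
      hballs hgrads fun m k hmk => hIs m k hmk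
  have hσge : ∀ k, k ≤ σ k := fun k => hσ.id_le k
  -- ## Step 3: vorticity compactness along `σ`
  have hballσ : ∀ m k : ℕ, m ≤ k → IsSuitableWeakSolutionInBall ((2 : ℝ) ^ m) 0 (v (σ k)) (q (σ k)) :=
    fun m k hmk => hballs m (σ k) (hmk.trans (hσge k))
  have hbdσ : ∀ m k : ℕ, m ≤ k →
      typeIBound (parabolicCylinder ((2 : ℝ) ^ m) (0 : ℝ × (EuclideanSpace ℝ (Fin 3)))) (v (σ k)) (q (σ k)) (Gz (σ k)) ≤
        typeIBound (parabolicCylinder 1 (0 : ℝ × (EuclideanSpace ℝ (Fin 3)))) u p G :=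
    fun m k hmk => hIs m (σ k) (hmk.trans (hσge k))
  have hMσ : ∀ k : ℕ, ∀ᵐ w ∂(volume.restrict (parabolicCylinder ((2 : ℝ) ^ k) (0 : ℝ × (EuclideanSpace ℝ (Fin 3))))),
      ‖v (σ k) w.1 w.2‖ ≤ 1 := by
    intro k
    filter_upwards [ae_restrict_mem (isOpen_parabolicCylinder ((2 : ℝ) ^ k) (0 : ℝ × (EuclideanSpace ℝ (Fin 3)))).measurableSet]
      with w hw
    refine hbd1 (σ k) w (parabolicCylinder_mono (by positivity) ?_ _ hw)
    exact pow_le_pow_right₀ (by norm_num) ((hσge k).trans (Nat.le_succ _))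
  have hUm : ∀ R : ℝ, 0 < R → AEStronglyMeasurable (uncurry U)
      (volume.restrict (parabolicCylinder R (0 : ℝ × (EuclideanSpace ℝ (Fin 3))))) := fun R hR => (hmemU R hR).1
  obtain ⟨ψ, V, W, hψ, hVae, hVc, hVcd, hUW, hWc, hWd, hpt, hfd, hcurl⟩ :=
    exists_subseq_curl_limit hI hballσ hbdσ hMσ hUm hconvU
  -- ## Step 4: `‖U‖ ≤ 1` a.e. on the slab, and the truncation
  have hlevel : ∀ R : ℝ, ∃ m : ℕ, R ≤ (2 : ℝ) ^ m := fun R => by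
    obtain ⟨m, hm⟩ := pow_unbounded_of_one_lt R (by norm_num : (1 : ℝ) < 2)
    exact ⟨m, hm.le⟩
  have hσge' : ∀ m j, m ≤ σ (j + m) := fun m j => (Nat.le_add_left m j).trans (hσge (j + m))
  have hmeas : ∀ m k : ℕ, m ≤ k → ∀ {R : ℝ}, 0 < R → R ≤ (2 : ℝ) ^ m →
      AEStronglyMeasurable (uncurry (v k)) (volume.restrict (parabolicCylinder R (0 : ℝ × (EuclideanSpace ℝ (Fin 3))))) := by
    intro m k hmk R hR0 hR
    exact (hballs m k hmk).1.distributional.1.aestronglyMeasurable.mono_measure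
      (Measure.restrict_mono (parabolicCylinder_mono hR0.le hR _) le_rfl)
  have hUbd : ∀ R : ℝ, 0 < R → ∀ᵐ w ∂(volume.restrict (parabolicCylinder R (0 : ℝ × (EuclideanSpace ℝ (Fin 3))))),
      ‖uncurry U w‖ ≤ 1 := by
    intro R hR
    obtain ⟨m, hm⟩ := hlevel R
    refine ae_norm_le_of_tendsto_eLpNorm (v := fun j => v (σ (j + m)))
      (fun j => hmeas m _ (hσge' m j) hR hm) (hmemU R hR).1
      ((hconvU R hR).comp (tendsto_add_atTop_nat m)) fun j => ?_
    filter_upwards [ae_restrict_mem (isOpen_parabolicCylinder R (0 : ℝ × (EuclideanSpace ℝ (Fin 3)))).measurableSet]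
      with w hw
    refine hbd1 _ w (parabolicCylinder_mono hR.le (hm.trans ?_) _ hw)
    exact pow_le_pow_right₀ (by norm_num) (by linarith [hσge' m j])
  have hUbd' : ∀ᵐ w ∂(volume.restrict (Iio (0 : ℝ) ×ˢ (univ : Set (EuclideanSpace ℝ (Fin 3))))), ‖uncurry U w‖ ≤ 1 := by
    refine ae_restrict_of_ae_restrict_of_subset lowerHalf_subset_iUnion' ?_
    rw [ae_restrict_iUnion_iff]
    exact fun n => hUbd _ (by positivity)
  classical
  set Ut : ℝ → (EuclideanSpace ℝ (Fin 3)) → (EuclideanSpace ℝ (Fin 3)) :=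
    fun t x => if ‖U t x‖ ≤ 1 then U t x else 0 with hUt
  have hUt_bd : ∀ t x, ‖Ut t x‖ ≤ 1 := fun t x => by
    simp only [hUt]
    split_ifs with h
    · exact h
    · simp
  have hUt_ae : ∀ᵐ w ∂(volume.restrict (Iio (0 : ℝ) ×ˢ (univ : Set (EuclideanSpace ℝ (Fin 3))))),
      uncurry U w = uncurry Ut w := by
    filter_upwards [hUbd'] with w hw
    rcases w with ⟨t, x⟩
    show U t x = Ut t x
    simp only [hUt, if_pos (show ‖U t x‖ ≤ 1 from hw)]
  have hslab : ((slab (EuclideanSpace ℝ (Fin 3)) (Iio 0) isOpen_Iio : Opens (ℝ × (EuclideanSpace ℝ (Fin 3)))) :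
      Set (ℝ × (EuclideanSpace ℝ (Fin 3)))) = Iio (0 : ℝ) ×ˢ (univ : Set (EuclideanSpace ℝ (Fin 3))) := coe_slab _ _
  have hUt_ae' : ∀ᵐ w ∂(volume.restrict ((slab (EuclideanSpace ℝ (Fin 3)) (Iio 0) isOpen_Iio :
      Opens (ℝ × (EuclideanSpace ℝ (Fin 3)))) : Set (ℝ × (EuclideanSpace ℝ (Fin 3))))),
      uncurry U w = uncurry Ut w := by rw [hslab]; exact hUt_ae
  have hswUt : IsSuitableWeakSolutionOn (slab (EuclideanSpace ℝ (Fin 3)) (Iio 0) isOpen_Iio) 1 0 Ut P :=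
    hswU.congr_ae hUt_ae' (ae_of_all _ fun _ => rfl)
  have hIUt : typeIBound (Iio (0 : ℝ) ×ˢ univ) Ut P H ≤
      4 * typeIBound (parabolicCylinder 1 (0 : ℝ × (EuclideanSpace ℝ (Fin 3)))) u p G := by
    rw [← typeIBound_congr_ae (p := P) (G := H) hUt_ae]; exact h4I
  have hIUt_top : typeIBound (Iio (0 : ℝ) ×ˢ univ) Ut P H < ⊤ :=
    lt_of_le_of_lt hIUt (ENNReal.mul_lt_top (by norm_num) hI)
  -- ## Step 5: the Oseen-mild representative
  obtain ⟨Vo, hVoae, hVoc, hVodiv, hVomild, hVoB⟩ :=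
    exists_oseenMild_repr_of_bounded hswUt (fun t _ x => hUt_bd t x) hIUt_top
  have hUVo : ∀ᵐ w ∂(volume.restrict (Iio (0 : ℝ) ×ˢ (univ : Set (EuclideanSpace ℝ (Fin 3))))),
      uncurry U w = uncurry Vo w := by
    filter_upwards [hUt_ae, hVoae] with w h1 h2
    rw [h1, h2]
  have hVoae' : ∀ᵐ w ∂(volume.restrict ((slab (EuclideanSpace ℝ (Fin 3)) (Iio 0) isOpen_Iio :
      Opens (ℝ × (EuclideanSpace ℝ (Fin 3)))) : Set (ℝ × (EuclideanSpace ℝ (Fin 3))))),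
      uncurry Ut w = uncurry Vo w := by rw [hslab]; exact hVoae
  -- `Vo = W` on the open slab (two continuous representatives of `U`)
  have hWVo : EqOn (uncurry W) (uncurry Vo) (Iio (0 : ℝ) ×ˢ (univ : Set (EuclideanSpace ℝ (Fin 3)))) :=
    Measure.eqOn_open_of_ae_eq (hUW.symm.trans hUVo) (isOpen_Iio.prod isOpen_univ) hWc hVoc
  have hWVo' : ∀ t < 0, W t = Vo t := fun t ht => funext fun x => hWVo (show ((t, x) : ℝ × (EuclideanSpace ℝ (Fin 3))) ∈
    Iio (0 : ℝ) ×ˢ (univ : Set (EuclideanSpace ℝ (Fin 3))) from ⟨ht, mem_univ _⟩)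
  -- ## Step 6: the zoom data
  set κ : ℕ → ℕ := fun j => σ (ψ j) with hκ
  set Λ : ℕ → ℝ := fun j => lam (κ j) with hΛ
  set T : ℕ → ℝ := fun j => (zs (κ j)).1 with hT
  set X : ℕ → (EuclideanSpace ℝ (Fin 3)) := fun j => (zs (κ j)).2 with hX
  have hκ_mono : StrictMono κ := hσ.comp hψ
  have hκge : ∀ j, j ≤ κ j := fun j => hκ_mono.id_le j
  have hψκ : ∀ j, ψ j ≤ κ j := fun j => hσge (ψ j)
  -- the scales: `(2^(k+1) λ_k)² < 1`
  have hscale : ∀ k, ((2 : ℝ) ^ (k + 1) * lam k) ^ 2 < 1 := by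
    intro k
    have h1 : ((zs k).1 - ((2 : ℝ) ^ (k + 1) * lam k) ^ 2, (zs k).2) ∈
        parabolicCylinder 1 (0 : ℝ × (EuclideanSpace ℝ (Fin 3))) :=
      hbox k ⟨⟨le_rfl, by nlinarith [sq_nonneg ((2 : ℝ) ^ (k + 1) * lam k)]⟩,
        mem_closedBall_self (mul_nonneg (by positivity) (hlam k).le)⟩
    have h2 : ((zs k).1, (zs k).2) ∈ parabolicCylinder 1 (0 : ℝ × (EuclideanSpace ℝ (Fin 3))) :=
      hbox k ⟨⟨by nlinarith [sq_nonneg ((2 : ℝ) ^ (k + 1) * lam k)], le_rfl⟩,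
        mem_closedBall_self (mul_nonneg (by positivity) (hlam k).le)⟩
    rw [mem_parabolicCylinder] at h1 h2
    simp only [Prod.fst_zero, zero_sub, one_pow] at h1 h2
    linarith [h1.1.1, h2.1.2]
  have hlam_le : ∀ k, lam k ≤ 1 / (2 : ℝ) ^ (k + 1) := by
    intro k
    have h2k : (0 : ℝ) < (2 : ℝ) ^ (k + 1) := by positivity
    have h1 : (2 : ℝ) ^ (k + 1) * lam k < 1 := by
      have hnn : (0 : ℝ) ≤ (2 : ℝ) ^ (k + 1) * lam k := mul_nonneg (by positivity) (hlam k).le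
      nlinarith [hscale k]
    rw [le_div_iff₀ h2k]
    linarith [mul_comm ((2 : ℝ) ^ (k + 1)) (lam k)]
  have hΛpos : ∀ j, 0 < Λ j := fun j => hlam (κ j)
  have hΛ0 : Tendsto Λ atTop (𝓝 0) := by
    have h1 : Tendsto (fun j : ℕ => 1 / (2 : ℝ) ^ (κ j + 1)) atTop (𝓝 0) := by
      have h2 : Tendsto (fun n : ℕ => 1 / (2 : ℝ) ^ n) atTop (𝓝 0) := by
        simpa using tendsto_pow_atTop_nhds_zero_of_lt_one (by norm_num : (0 : ℝ) ≤ 1 / 2) (by norm_num)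
      exact h2.comp ((tendsto_add_atTop_nat 1).comp hκ_mono.tendsto_atTop)
    exact squeeze_zero (fun j => (hΛpos j).le) (fun j => hlam_le (κ j)) h1
  -- the physical points stay in `Q(0, 1)`
  have hphys : ∀ k, ∀ s ∈ Icc (-((2 : ℝ) ^ (k + 1)) ^ 2) 0, ∀ y ∈ closedBall (0 : (EuclideanSpace ℝ (Fin 3))) ((2 : ℝ) ^ (k + 1)),
      ((zs k).1 + lam k ^ 2 * s, (zs k).2 + lam k • y) ∈ parabolicCylinder 1 (0 : ℝ × (EuclideanSpace ℝ (Fin 3))) := by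
    intro k s hs y hy
    refine hbox k ⟨⟨?_, ?_⟩, ?_⟩
    · have : lam k ^ 2 * s ≥ -(((2 : ℝ) ^ (k + 1) * lam k) ^ 2) := by nlinarith [hs.1, sq_nonneg (lam k)]
      linarith
    · nlinarith [hs.2, sq_nonneg (lam k)]
    · rw [mem_closedBall, dist_eq_norm, add_sub_cancel_left, norm_smul, Real.norm_of_nonneg (hlam k).le]
      have := mem_closedBall_zero_iff.1 hy
      nlinarith [hlam k]
  have hev_box : ∀ s < 0, ∀ y : (EuclideanSpace ℝ (Fin 3)), ∀ᶠ j in atTop,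
      s ∈ Ioo (-((2 : ℝ) ^ (ψ j)) ^ 2) 0 ∧ y ∈ ball (0 : (EuclideanSpace ℝ (Fin 3))) ((2 : ℝ) ^ (ψ j)) := by
    intro s hs y
    obtain ⟨m, hm⟩ := hlevel (max (Real.sqrt (-s)) ‖y‖ + 1)
    filter_upwards [eventually_ge_atTop m] with j hj
    have hjm : (2 : ℝ) ^ m ≤ (2 : ℝ) ^ (ψ j) := pow_le_pow_right₀ (by norm_num) (hj.trans (hψ.id_le j))
    have hR : max (Real.sqrt (-s)) ‖y‖ + 1 ≤ (2 : ℝ) ^ (ψ j) := hm.trans hjm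
    have h1 : Real.sqrt (-s) < (2 : ℝ) ^ (ψ j) := by linarith [le_max_left (Real.sqrt (-s)) ‖y‖]
    have h2 : ‖y‖ < (2 : ℝ) ^ (ψ j) := by linarith [le_max_right (Real.sqrt (-s)) ‖y‖]
    refine ⟨⟨?_, hs⟩, mem_ball_zero_iff.2 h2⟩
    have hsq := Real.sq_sqrt (neg_pos.2 hs).le
    nlinarith [Real.sqrt_nonneg (-s)]
  -- physical points of the `j`-th zoom on `Q(0, 2^(ψ j))` lie in `Q(0, 1)`
  have hR_le : ∀ j, (2 : ℝ) ^ (ψ j) ≤ (2 : ℝ) ^ (κ j + 1) := fun j =>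
    pow_le_pow_right₀ (by norm_num) ((hψκ j).trans (Nat.le_succ _))
  have hphys' : ∀ j, ∀ s ∈ Ioo (-((2 : ℝ) ^ (ψ j)) ^ 2) 0, ∀ y ∈ ball (0 : (EuclideanSpace ℝ (Fin 3))) ((2 : ℝ) ^ (ψ j)),
      T j + Λ j ^ 2 * s ∈ Ioo (-1 : ℝ) 0 ∧ X j + Λ j • y ∈ ball (0 : (EuclideanSpace ℝ (Fin 3))) 1 := by
    intro j s hs y hy
    have hs' : s ∈ Icc (-((2 : ℝ) ^ (κ j + 1)) ^ 2) 0 := by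
      refine ⟨?_, hs.2.le⟩
      have := pow_le_pow_left₀ (by positivity) (hR_le j) 2
      linarith [hs.1]
    have hy' : y ∈ closedBall (0 : (EuclideanSpace ℝ (Fin 3))) ((2 : ℝ) ^ (κ j + 1)) :=
      mem_closedBall_zero_iff.2 ((mem_ball_zero_iff.1 hy).le.trans (hR_le j))
    have h := hphys (κ j) s hs' y hy'
    rw [mem_parabolicCylinder] at h
    simp only [Prod.fst_zero, Prod.snd_zero, zero_sub, one_pow] at h
    exact ⟨⟨h.1.1, h.1.2⟩, mem_ball.2 h.2⟩
  -- ## Step 7: the vorticity of the representatives is the zoomed vorticity of `u`, a.e. in time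
  set vz : ℕ → ℝ → (EuclideanSpace ℝ (Fin 3)) → (EuclideanSpace ℝ (Fin 3)) :=
    fun k => lam k • stPull (lam k ^ 2) (lam k) (zs k).1 (zs k).2 u with hvz
  have hzoom_ae : ∀ k, uncurry (v k) =ᵐ[volume] uncurry (vz k) := by
    intro k
    have hq := (quasiMeasurePreserving_stAffine (pow_pos (hlam k) 2) (hlam k) (zs k).1 (zs k).2
      (E := EuclideanSpace ℝ (Fin 3))).ae_eq_comp (g := uncurry u) (g' := uncurry uh) hae
    filter_upwards [hq] with w hw
    rw [hvform k]
    rcases w with ⟨s, y⟩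
    simp only [comp_apply, stAffine_apply, uncurry_apply_pair] at hw
    show (lam k • stPull (lam k ^ 2) (lam k) (zs k).1 (zs k).2 uh) s y =
      (lam k • stPull (lam k ^ 2) (lam k) (zs k).1 (zs k).2 u) s y
    rw [smul_stPull_apply, smul_stPull_apply, hw]
  have hVvz : ∀ j, uncurry (V j) =ᵐ[volume.restrict (parabolicCylinder ((2 : ℝ) ^ (ψ j)) (0 : ℝ × (EuclideanSpace ℝ (Fin 3))))]
      uncurry (vz (κ j)) := fun j => (hVae j).symm.trans (ae_restrict_of_ae (hzoom_ae (κ j)))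
  -- the identity on one slice, from a.e. equality and continuity of both slices
  have hslice : ∀ j, ∀ s ∈ Ioo (-((2 : ℝ) ^ (ψ j)) ^ 2) (0 : ℝ),
      (∀ᵐ y ∂(volume.restrict (ball (0 : (EuclideanSpace ℝ (Fin 3))) ((2 : ℝ) ^ (ψ j)))), V j s y = vz (κ j) s y) →
      ∀ y ∈ ball (0 : (EuclideanSpace ℝ (Fin 3))) ((2 : ℝ) ^ (ψ j)),
        curl (V j s) y = Λ j ^ 2 • curl (u (T j + Λ j ^ 2 * s)) (X j + Λ j • y) := by
    intro j s hs hy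
    -- continuity of the two slices on the ball
    have hc1 : ContinuousOn (V j s) (ball (0 : (EuclideanSpace ℝ (Fin 3))) ((2 : ℝ) ^ (ψ j))) := by
      intro y hyb
      have hmem : ((s, y) : ℝ × (EuclideanSpace ℝ (Fin 3))) ∈
          parabolicCylinder ((2 : ℝ) ^ (ψ j)) (0 : ℝ × (EuclideanSpace ℝ (Fin 3))) := by
        rw [mem_parabolicCylinder]
        simp only [Prod.fst_zero, Prod.snd_zero, zero_sub]
        exact ⟨⟨hs.1, hs.2⟩, by simpa [dist_zero_right] using mem_ball_zero_iff.1 hyb⟩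
      exact ((hVcd j (s, y) hmem).continuousAt).continuousWithinAt
    have hts : T j + Λ j ^ 2 * s ∈ Ioo (-1 : ℝ) 0 := (hphys' j s hs 0 (mem_ball_self (by positivity))).1
    have hc2 : ContinuousOn (vz (κ j) s) (ball (0 : (EuclideanSpace ℝ (Fin 3))) ((2 : ℝ) ^ (ψ j))) := by
      have hmaps : MapsTo (fun y : (EuclideanSpace ℝ (Fin 3)) => X j + Λ j • y)
          (ball (0 : (EuclideanSpace ℝ (Fin 3))) ((2 : ℝ) ^ (ψ j))) (ball (0 : (EuclideanSpace ℝ (Fin 3))) 1) :=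
        fun y hyb => (hphys' j s hs y hyb).2
      have hcu : ContinuousOn (fun y : (EuclideanSpace ℝ (Fin 3)) => u (T j + Λ j ^ 2 * s) (X j + Λ j • y))
          (ball (0 : (EuclideanSpace ℝ (Fin 3))) ((2 : ℝ) ^ (ψ j))) :=
        (hC1 _ hts).continuousOn.comp (by fun_prop) hmaps
      have he : vz (κ j) s = fun y => lam (κ j) • u (T j + Λ j ^ 2 * s) (X j + Λ j • y) := by
        funext y; rfl
      rw [he]
      exact (continuousOn_const (c := lam (κ j))).smul hcu
    have heq : EqOn (V j s) (vz (κ j) s) (ball (0 : (EuclideanSpace ℝ (Fin 3))) ((2 : ℝ) ^ (ψ j))) :=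
      eqOn_ball_of_ae_eq hy hc1 hc2
    intro y hyb
    rw [curl_eq_of_eqOn_ball heq hyb]
    show curl ((lam (κ j) • stPull (lam (κ j) ^ 2) (lam (κ j)) (zs (κ j)).1 (zs (κ j)).2 u) s) y = _
    rw [curl_smul_stPull, ← pow_two]
  -- a.e. in `s < 0`, simultaneously for all `j`
  have hae_j : ∀ j, ∀ᵐ s ∂(volume.restrict (Iio (0 : ℝ))), s ∈ Ioo (-((2 : ℝ) ^ (ψ j)) ^ 2) (0 : ℝ) →
      ∀ y ∈ ball (0 : (EuclideanSpace ℝ (Fin 3))) ((2 : ℝ) ^ (ψ j)),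
        curl (V j s) y = Λ j ^ 2 • curl (u (T j + Λ j ^ 2 * s)) (X j + Λ j • y) := by
    intro j
    have hf := ae_ae_of_ae_parabolicCylinder (hVvz j)
    have hf' : ∀ᵐ s ∂(volume : Measure ℝ), s ∈ Ioo (-((2 : ℝ) ^ (ψ j)) ^ 2) (0 : ℝ) →
        ∀ᵐ y ∂(volume.restrict (ball (0 : (EuclideanSpace ℝ (Fin 3))) ((2 : ℝ) ^ (ψ j)))),
          uncurry (V j) (s, y) = uncurry (vz (κ j)) (s, y) := (ae_restrict_iff' measurableSet_Ioo).1 hf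
    refine ae_restrict_of_ae ?_
    filter_upwards [hf'] with s hs hsI
    exact hslice j s hsI (hs hsI)
  have hae_all : ∀ᵐ s ∂(volume.restrict (Iio (0 : ℝ))), ∀ j, s ∈ Ioo (-((2 : ℝ) ^ (ψ j)) ^ 2) (0 : ℝ) →
      ∀ y ∈ ball (0 : (EuclideanSpace ℝ (Fin 3))) ((2 : ℝ) ^ (ψ j)),
        curl (V j s) y = Λ j ^ 2 • curl (u (T j + Λ j ^ 2 * s)) (X j + Λ j • y) :=
    ae_all_iff.2 hae_j
  -- ## Assembly
  refine ⟨Vo, P, H, Λ, T, X, hVoc, hVodiv, hVomild, hVoB,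
    hswUt.congr_ae hVoae' (ae_of_all _ fun _ => rfl), (hHU.congr_ae hUt_ae').congr_ae hVoae',
    ?_, ?_, fun t ht x => hWVo' t ht ▸ hWd t ht x, hΛpos, hΛ0, ?_, ?_⟩
  · -- non-triviality (the uniform `L³` mass of file `Nontrivial`)
    intro hV0
    have hU0 : ∀ᵐ w ∂(volume.restrict (parabolicCylinder 1 (0 : ℝ × (EuclideanSpace ℝ (Fin 3))))), uncurry U w = 0 := by
      refine ae_restrict_of_ae_restrict_of_subset (parabolicCylinder_subset_lowerHalf le_rfl 1) ?_
      filter_upwards [hUVo, hV0] with w h1 h2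
      rw [h1, h2]
      rfl
    obtain ⟨m₀, hm₀, hlow⟩ := exists_eLpNorm_lower_bound hI hballs
      (fun m k hmk => hIs m k hmk) hbd1 hvtx hcontAt hcontOn
    have hconv1 := (hconvU 1 one_pos).comp (tendsto_add_atTop_nat 3)
    have hle : ∀ j, m₀ ≤ eLpNorm (uncurry (v (σ (j + 3))) - uncurry U) 3
        (volume.restrict (parabolicCylinder 1 (0 : ℝ × (EuclideanSpace ℝ (Fin 3))))) := by
      intro j
      have hk : 3 ≤ σ (j + 3) := hσge' 3 j
      refine (hlow _ hk).trans (le_of_eq (eLpNorm_congr_ae ?_))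
      filter_upwards [hU0] with w hw
      rw [Pi.sub_apply, hw, sub_zero]
    have : m₀ ≤ 0 := ge_of_tendsto' hconv1 hle
    exact hm₀.ne' (le_antisymm this bot_le)
  · -- `𝐈 < ⊤`
    rw [← typeIBound_congr_ae (p := P) (G := H) hVoae]
    exact hIUt_top
  · -- the physical points stay in `Q(0, 1)`
    intro s hs y
    filter_upwards [hev_box s hs y] with j hj
    exact hphys' j s hj.1 y hj.2
  · -- convergence of the zoomed vorticities, a.e. in `s`
    filter_upwards [hae_all, ae_restrict_mem measurableSet_Iio] with s hs hs0
    intro y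
    have hs0' : s < 0 := hs0
    have h1 : Tendsto (fun j => curl (V j s) y) atTop (𝓝 (curl (Vo s) y)) := by
      rw [← hWVo' s hs0']
      exact hcurl s hs0' y
    refine h1.congr' ?_
    filter_upwards [hev_box s hs0' y] with j hj
    exact hs j hj.1 y hj.2

end Literature.Analysis.FluidPDE.LocalTypeIBlowup

end
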